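import Literature.MathematicalPhysics.QuantumFieldTheory.Balaban1983to89.B8Prop7PrintedRZdGF3P2HalfSpaceAllL
import Literature.MathematicalPhysics.QuantumFieldTheory.Balaban1983to89.B8Prop7PrintedRZdGF3P2HalfSpaceCStar
import Literature.MathematicalPhysics.QuantumFieldTheory.Balaban1983to89.B8Prop7TowerAxialRecord
import Literature.MathematicalPhysics.QuantumFieldTheory.Balaban1983to89.Node00.CarriersB8SubBP2C
import Literature.MathematicalPhysics.QuantumFieldTheory.Balaban1983to89.Node00.Record12NumericsFamilyDict
import Literature.MathematicalPhysics.QuantumFieldTheory.Balaban1983to89.B8LeafKnitRS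

/-!
# `Balaban1983to89.B8Prop7PrintedRTowerAxialRecordP` — THE RECORD-KEYED FACES OF THE P₇-CURRENCY CERTIFICATE: [Balaban1985RegularSpaces] Proposition 7 AS
# TYPED-PRINTED (`B8SectGH.Prop7PrintedR`, constant `2α₂` in (1.145)), with its axial map PINNED to print's tower-wise map `toAxialTowerResid`, is FALSE on NODE 00's
# P-families of record `famB8OfRecordSubBP` ∕ `famB8OfRecordSubBP₂C` AT THE DICTIONARIES OF RECORD `Node00.stage3OfRecord₁₂` (`D = 4`, `L = 3`, `𝔸 = ℂ`) and
# `Node00.stage3OfFamily F` (`D = 4`, `L = F.L ≥ 13`, `𝔸 = ℂ`); hence the RS-currency leaf `B8LeafRS` over the pinned P₂C data is uninhabited there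

statement-level skeleton of published theorems with citation tags; proofs where landed; nothing here is a claim about the Yang–Mills mass gap

T. Bałaban, *Spaces of regular gauge field configurations on a lattice and gauge fixing conditions*, Commun. Math. Phys. **99** (1985) 75–102
`[Balaban1985RegularSpaces]` ("B8"; journal page = PDF page + 74): Prop. 7 (1.143)–(1.145) p. 100, (1.35) p. 82, (1.3)–(1.6) p. 77, p. 77 (bond convention), Lemma 1 – Thm 8
pp. 79–101 (the leaf).  Cell GAPS G-B8-01 (the constant of (1.145) on the bonds crossing `∂Λ_j`).

## WHY THIS FILE (cell `pub-ymgap`, HUMAN RULING D-0062 ∕ D-0149 ∕ D-0154; N05 = [B8]; width seat `pub-ymgap-dag-n05-w5` g2; the piece «(ii) record-keyed ¬P₇» located by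
## dag-n05-w2 g2 (HANDOFF §Update 04:47Z), by this seat's g0 (`B8Prop7PrintedRZdGF3P2HalfSpaceAllL` HONEST SCOPE) and by referee dag-ref-P g1 (READ of p607226))

The P₇-currency necessity certificate is landed at the CARRIER ∕ MEMBER level: r05's `B8Ineq145Lineage` (the crossing-bond witness, `d = 4`, `L = 3`, `𝔸 = ℂ`), n05-w2's
`B8Prop7PrintedRZdGF3P2HalfSpace` (transport to NODE 00's δ₂ carrier `zdGF3HP₂` with print's pinned map `toAxialTower` at the lawful admissible half-space member, `L = 3`)
and g0's `B8Prop7PrintedRZdGF3P2HalfSpaceAllL` (every `L ≥ 3`).  The K1 record knits, however, display Proposition 7 KEYED BY A RECORD `θ : Node00.Stage3Params`: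
`p7 : B8SectGH.Prop7PrintedR (fun j : IdxB8SubB θ => famB8OfRecordSubBP θ λ.β λ.len j) (fun j => λ.toAxial j.1)` (`Node00.Record13CarriersB8SubBPCoPH` and its CoP ∕ CoPR ∕
X-view twins), and the «P₂C» slot is typed over `IdxB8SubC θ` with the map pinned, `toAxial := fun j => toAxialTowerResid θ λ.β λ.len j.1.1` (`Node00.CarriersB8SubBP2C`).
n05-w2 g2 located the record-keyed face as «needs a `Stage3Params` θ with `(D, L, 𝔸) = (4, 3, ℂ)` (not constructed anywhere)».  It IS constructed: the dictionary of
record `Node00.stage3OfRecord₁₂` (`Node00/Record12Numerics`: `D := 4`, `L := 3`, `𝔸 := ℂ`) and the FAMILY DICTIONARY `Node00.stage3OfFamily F` (`Node00/Record12NumericsFamilyDict`: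
the same with `L := F.L`, print's odd `L > 11`) — the `θ.toStage3Params` of the Record-12∕13 numerics, live-selector and `…AtRecord13Family` witnesses.  At both, `θ₀.D = 4`
holds by `rfl`, `famB8OfRecordSubBP₂C θ₀ β len j` IS `zdGF3HP₂ θ₀.𝔸 θ₀.L β len j.1.1.1` and `toAxialTowerResid θ₀ β len j.1.1` IS `toAxialTower θ₀.𝔸 θ₀.L β len _ j.1.1.1`,
and the C⋆-GENERIC member-level certificate `B8Prop7PrintedRZdGF3P2HalfSpaceCStar.not_prop7PrintedR_zdGF3HP₂_toAxialTower_halfspace_cstar θ₀.𝔸 …` instantiates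
WHATEVER `θ₀.𝔸` IS (EDITION director-ym №260, FLAG №14 T0 (γ), 2026-08-29: the two record-keyed `obtain`s of §2∕§3 formerly read the `ℂ`-certificate
`…P2HalfSpaceAllL.not_prop7PrintedR_zdGF3HP₂_toAxialTower_halfspace_allL` through `θ₀.𝔸 = ℂ` by `rfl`; they now read the C⋆-generic twin BY NAME, so every statement
of this file survives the RECORD-NONABELIAN re-key `stage3OfRecord₁₂.𝔸 := Matrix (Fin 2) (Fin 2) ℂ` (director-ym №256 (2)) verbatim — statements, names and §1 untouched).
THIS FILE writes those faces down, in the exact binder shapes the record files display.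

## WHAT IS PROVED (kernel, 0 sorry; theorems only)

* §1 (member level, the P-carriers) `not_prop7PrintedR_zdGF3HP_toAxialTower_halfspace_allL` ∕ `…zdGF3P…`: g0's δ₂ theorem read on `zdGF3HP` ∕ `zdGF3P` (the six fields
  Proposition 7 reads — `Cfg`, `Pert`, `InA`, `C140`, `InAAx`, `avgClose` — agree by `rfl` across `zdGF3P`, `zdGF3HP`, `zdGF3P₂`, `zdGF3HP₂`), every `L ≥ 3`.
* §2 (the family dictionary `θ₀ := stage3OfFamily F`, every `T4Family F`, any `β`, `len`) ★ `exists_idxB8SubC_not_prop7PrintedR_stage3OfFamily` — a member `j : IdxB8SubC θ₀`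
  (lawful, admissible, `Ω = {x₀ ≥ 0}` half-space tower) at which the typed-printed sentence for `famB8OfRecordSubBP₂C θ₀ β len j` with `toAxialTowerResid` already fails;
  ★★ `not_prop7PrintedR_famB8OfRecordSubBP_toAxialTowerResid_stage3OfFamily` — the K1 record knits' `p7` binder over `IdxB8SubB θ₀` with `λ.toAxial` PINNED to print's map
  is FALSE; ★★ `not_prop7PrintedR_famB8OfRecordSubBP₂C_toAxialTowerResid_stage3OfFamily` — the same over the P₂C slot's index `IdxB8SubC θ₀`; `…famB8OfRecordSubBP_domainSeq…`
  — over the admissible subtype `{j : IdxB8SubB θ₀ ∕∕ DomainSeq θ₀.L j.1.1.Ω}` (n05-w1's `B8Prop7TowerAxialRecordP` index); ★ `not_b8LeafRS_famB8OfRecordSubBP₂C_toAxialTowerResid_stage3OfFamily`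
  ∕ `not_b8LeafRS_famB8OfRecordSubBP_toAxialTowerResid_stage3OfFamily` — for ALL residual constants and carriers `C₂ B₁′ B₀′ B₁ B₂ c₁ inp B₀β loc lan cub`, the RS-currency
  leaf `B8LeafKnitRS.B8LeafRS` over the pinned P₂C (resp. P) data is uninhabited: the hypothesis of `Node00.CarriersB8SubBP2C.b8LeafOfRecordSubBP₂C_of_b8LeafRS_pinned` («RS ⇒
  slot, never conversely») has NO instance at the family dictionary.
* §3 the same five faces at the closed dictionary `θ₀ := stage3OfRecord₁₂` (`L = 3`).

## HONEST SCOPE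

NEGATIVE certificates about a proof CURRENCY (the typed-printed constant `2α₂` of (1.145), for print's PINNED tower-wise axial map) read at NODE 00's own dictionaries
of record (`𝔸 = ℂ`, `D = 4`); NO estimate of [Balaban1985RegularSpaces] is proved or denied; nothing is said against the REPAIRED currency `B8Ineq145.Prop7RepairedC
(c₇OfRecord θ)` in which the «P₂C» slot is typed (`Node00.CarriersB8SubBP2C.prop7_famB8OfRecordSubBP₂C` HOLDS at every `θ`), nor about a free (unpinned) `λ.toAxial`
(`B8Prop7GlevZd3P.prop7PrintedR_zdGF3HP_unitAxial_comp`: a junk map makes the typed sentence true).  Records `θ` other than the two dictionaries of record are covered by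
the C⋆-generic twin `B8Prop7PrintedRZdGF3P2HalfSpaceCStar` §2 (any `θ` with `θ.D = 4`), which §2∕§3 here now read.  Count-neutral helper keyed `stmt-QuantumFields-20542` (K1⁷); N05 NOT
discharged; no count claim; `T_η ↦ ℤᵈ`; one finite `𝕋⁴` programme at fixed `ε`, Bałaban AS PRINTED; the Yang–Mills mass gap (Clay) is NOT proved by any of this — R4
closes the conditional finite-`𝕋⁴` rung `BalabanLadder.UV` only; nothing continuum ∕ ℝ⁴ ∕ OS.  No `sorry`, no `def`, no `instance`, no `notation`.  Unit
`pub-ymgap-dag-n05-w5` (g2), 2026-08-28.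

RELATED, NOT DUPLICATED: `B8Prop7PrintedRZdGF3P2HalfSpaceAllL` ∕ `B8Prop7PrintedRZdGF3P2HalfSpace` ∕ `B8Ineq145Lineage` (the member-level certificate, USED by name);
`B8Prop7TowerAxialRecord` (`toAxialTowerResid`), `B8Prop7TowerAxialRecordP` ∕ `Node00.CarriersB8SubBP2C` (the POSITIVE repaired-currency faces at records — the other
currency); `Node00.Record12Numerics` ∕ `Node00.Record12NumericsFamilyDict` (the dictionaries); `B8LeafKnit.prop7PrintedR_precomp` (restriction of the family index, USED);
`B8LeafKnitRS` (the RS leaf shape).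

[cite: Balaban1985RegularSpaces, Prop. 7 (1.143)–(1.145) p.100, (1.35) p.82, (1.3)–(1.6) p.77, p.77; Lemma 1 – Thm 8 pp.79–101]
-/

noncomputable section

namespace Literature.MathematicalPhysics.QuantumFieldTheory.Balaban1983to89.B8Prop7PrintedRTowerAxialRecordP

open Node00 (Stage3Params IdxB8 famB8OfRecord stage3OfFamily stage3OfRecord₁₂ IdxB8SubC famB8OfRecordSubBP₂C famB8OfRecordSubBP)
open B8IdxB8LawsB (IdxB8LawsB IdxB8SubB)
open B8Prop7TowerAxialRecord (toAxialTowerResid)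
open B8Prop7TowerAxialZd3 (toAxialTower)
open B8LeafModelZd3P2 (zdGF3P₂ zdGF3HP₂)
open B8LeafModelZd3P (zdGF3P zdGF3HP)
open B8LeafModelZd (ZdIdx)
open B8ConstraintBonds (DomainSeq)
open B8Prop7HalfSpace (OmegaHS)
open B8Prop7PrintedRZdGF3P2HalfSpaceAllL (not_prop7PrintedR_zdGF3HP₂_toAxialTower_halfspace_allL)
open B8Prop7PrintedRZdGF3P2HalfSpaceCStar (not_prop7PrintedR_zdGF3HP₂_toAxialTower_halfspace_cstar)
open B8LeafKnit (prop7PrintedR_precomp)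
open B8LeafKnitRS (B8LeafRS)
open T4Continuum (T4Family)

-- `Site` alone could resolve to the torus sites of `Setup.lean`; re-export the `ℤ^d` sites of `B7Prop1Explicit`.
export B7Prop1Explicit (Site)

/-! ## §1 Member level: the certificate read on the P-carriers `zdGF3HP` ∕ `zdGF3P` (Proposition 7 reads the same six fields as on the δ₂ carriers) -/

/-- **The typed-printed Proposition 7 is FALSE on the P-carrier `zdGF3HP`** with print's pinned tower-wise map at the lawful admissible half-space member, every
`L ≥ 3` (`d = 4`, `𝔸 = ℂ`): g0's `not_prop7PrintedR_zdGF3HP₂_toAxialTower_halfspace_allL` — the fields `Cfg`, `Pert`, `InA`, `C140`, `InAAx`, `avgClose` of `zdGF3HP₂`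
ARE `zdGF3HP`'s (`B8LeafModelZd3P2.prop7PrintedR_zdGF3HP₂_iff` is `Iff.rfl`), so the same proof term elaborates. [cite: Balaban1985RegularSpaces, Prop. 7 (1.143)–(1.145) p.100, (1.35) p.82, p.77] -/
theorem not_prop7PrintedR_zdGF3HP_toAxialTower_halfspace_allL (L : ℕ) (hL : 3 ≤ L) (hL1 : 1 ≤ L) (β : ℝ) (len : Site 4 → ℝ) :
    ∃ i : ZdIdx 4 L, IdxB8LawsB L i ∧ DomainSeq L i.Ω ∧ i.Ω 0 = Set.univ ∧ i.Ω = OmegaHS (0 : Fin 4) ∧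
      ¬ B8SectGH.Prop7PrintedR (fun _ : Unit => zdGF3HP ℂ L β len i) (fun _ => toAxialTower ℂ L β len hL1 i) :=
  not_prop7PrintedR_zdGF3HP₂_toAxialTower_halfspace_allL L hL hL1 β len

/-- The same on the `zdGF3P` face (the fields Proposition 7 reads are `rfl`-equal), every `L ≥ 3`. [cite: Balaban1985RegularSpaces, Prop. 7 (1.144)–(1.145) p.100] -/
theorem not_prop7PrintedR_zdGF3P_toAxialTower_halfspace_allL (L : ℕ) (hL : 3 ≤ L) (hL1 : 1 ≤ L) (β : ℝ) (len : Site 4 → ℝ) :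
    ∃ i : ZdIdx 4 L, IdxB8LawsB L i ∧ DomainSeq L i.Ω ∧ i.Ω 0 = Set.univ ∧ i.Ω = OmegaHS (0 : Fin 4) ∧
      ¬ B8SectGH.Prop7PrintedR (fun _ : Unit => zdGF3P ℂ L β len i) (fun _ => toAxialTower ℂ L β len hL1 i) :=
  not_prop7PrintedR_zdGF3HP₂_toAxialTower_halfspace_allL L hL hL1 β len

/-! ## §2 The faces at the FAMILY DICTIONARY `stage3OfFamily F` (`D = 4` by `rfl`, any `𝔸`; `L = F.L`, odd, `> 11`) -/

section Family

variable (F : T4Family) (β : ℝ) (len : Site (stage3OfFamily F).D → ℝ)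

/-- `3 ≤ F.L` and `1 ≤ F.L` (print: «L an odd positive integer > 11»). [cite: Balaban1987RG1, (0.1) p.251 (bookkeeping)] -/
private theorem three_le_L : 3 ≤ F.L ∧ 1 ≤ F.L := by
  have := F.hL11
  exact ⟨by omega, by omega⟩

/-- ★ **A MEMBER OF THE P₂C SLOT's INDEX AT WHICH THE TYPED-PRINTED PROPOSITION 7 ALREADY FAILS** (family dictionary `θ₀ := stage3OfFamily F`, any `β`, `len`): a lawful
(`IdxB8LawsB`), admissible (`DomainSeq`, print's (1.3)–(1.4)) member `j : IdxB8SubC θ₀` with the half-space tower `Ω_j = {x₀ ≥ 0}` (`j ≥ 1`), for which `B8SectGH.Prop7PrintedR`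
of the one-member family `famB8OfRecordSubBP₂C θ₀ β len j` with print's pinned map `toAxialTowerResid θ₀ β len j.1.1` is FALSE — g0's crossing-bond certificate at `L := F.L`,
read through `θ₀.D = 4`, `θ₀.𝔸 = ℂ` (`rfl`). [cite: Balaban1985RegularSpaces, Prop. 7 (1.143)–(1.145) p.100, (1.3)–(1.4) p.77, p.77] -/
theorem exists_idxB8SubC_not_prop7PrintedR_stage3OfFamily :
    ∃ j : IdxB8SubC (stage3OfFamily F), j.1.1.1.Ω = OmegaHS (0 : Fin 4) ∧
      ¬ B8SectGH.Prop7PrintedR (fun _ : Unit => famB8OfRecordSubBP₂C (stage3OfFamily F) β len j)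
        (fun _ => toAxialTowerResid (stage3OfFamily F) β len j.1.1) := by
  obtain ⟨hL, hL1⟩ := three_le_L F
  -- RE-KEY-NEUTRAL (director-ym №260, FLAG №14 T0 (γ)): the C⋆-GENERIC member certificate at `𝔸 := (stage3OfFamily F).𝔸`, whatever that algebra is.
  obtain ⟨i, hlaws, hadm, hΩ0, hΩ, hnot⟩ :=
    not_prop7PrintedR_zdGF3HP₂_toAxialTower_halfspace_cstar (stage3OfFamily F).𝔸 F.L hL hL1 β len
  exact ⟨⟨⟨⟨i, hΩ0⟩, hlaws⟩, hadm⟩, hΩ, hnot⟩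

/-- ★★ **THE K1 RECORD KNITS' `p7` BINDER WITH THE AXIAL MAP PINNED IS FALSE AT THE FAMILY DICTIONARY**: for `θ₀ := stage3OfFamily F` (any `F`, `β`, `len`),
`¬ B8SectGH.Prop7PrintedR (fun j : IdxB8SubB θ₀ => famB8OfRecordSubBP θ₀ β len j) (fun j => toAxialTowerResid θ₀ β len j.1)` — the displayed conjunct of
`Node00.Record13CarriersB8SubBPCoPH` (and its CoP ∕ CoPR ∕ X-view twins) at `λ.toAxial := toAxialTowerResid θ₀ λ.β λ.len`.  By restriction of the family index
(`B8LeafKnit.prop7PrintedR_precomp`) to the member of `exists_idxB8SubC_not_prop7PrintedR_stage3OfFamily`. [cite: Balaban1985RegularSpaces, Prop. 7 (1.143)–(1.145) p.100, (1.35) p.82, p.77] -/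
theorem not_prop7PrintedR_famB8OfRecordSubBP_toAxialTowerResid_stage3OfFamily :
    ¬ B8SectGH.Prop7PrintedR (fun j : IdxB8SubB (stage3OfFamily F) => famB8OfRecordSubBP (stage3OfFamily F) β len j)
      (fun j => toAxialTowerResid (stage3OfFamily F) β len j.1) := by
  obtain ⟨j, -, hnot⟩ := exists_idxB8SubC_not_prop7PrintedR_stage3OfFamily F β len
  exact fun h => hnot (prop7PrintedR_precomp (fun _ : Unit => j.1) _ _ h)

/-- ★★ **… AND OVER THE «P₂C» SLOT's INDEX** `IdxB8SubC θ₀` (family `famB8OfRecordSubBP₂C θ₀ β len`, map `fun j => toAxialTowerResid θ₀ β len j.1.1` — the pinned data of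
`Node00.CarriersB8SubBP2C`), `θ₀ := stage3OfFamily F`. [cite: Balaban1985RegularSpaces, Prop. 7 (1.143)–(1.145) p.100, (1.3)–(1.4) p.77] -/
theorem not_prop7PrintedR_famB8OfRecordSubBP₂C_toAxialTowerResid_stage3OfFamily :
    ¬ B8SectGH.Prop7PrintedR (fun j : IdxB8SubC (stage3OfFamily F) => famB8OfRecordSubBP₂C (stage3OfFamily F) β len j)
      (fun j => toAxialTowerResid (stage3OfFamily F) β len j.1.1) := by
  obtain ⟨j, -, hnot⟩ := exists_idxB8SubC_not_prop7PrintedR_stage3OfFamily F β len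
  exact fun h => hnot (prop7PrintedR_precomp (fun _ : Unit => j) _ _ h)

/-- **… AND OVER THE ADMISSIBLE SUBTYPE** `{j : IdxB8SubB θ₀ ∕∕ DomainSeq θ₀.L j.1.1.Ω}` of n05-w1's `B8Prop7TowerAxialRecordP` faces (the P-members read there),
`θ₀ := stage3OfFamily F`. [cite: Balaban1985RegularSpaces, Prop. 7 (1.143)–(1.145) p.100, (1.3)–(1.4) p.77] -/
theorem not_prop7PrintedR_famB8OfRecordSubBP_domainSeq_toAxialTowerResid_stage3OfFamily :
    ¬ B8SectGH.Prop7PrintedR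
      (fun j : {j : IdxB8SubB (stage3OfFamily F) // DomainSeq (stage3OfFamily F).L j.1.1.Ω} => famB8OfRecordSubBP (stage3OfFamily F) β len j.1)
      (fun j => toAxialTowerResid (stage3OfFamily F) β len j.1.1) := by
  obtain ⟨j, -, hnot⟩ := exists_idxB8SubC_not_prop7PrintedR_stage3OfFamily F β len
  exact fun h => hnot (prop7PrintedR_precomp
    (fun _ : Unit => (⟨j.1, j.2⟩ : {j : IdxB8SubB (stage3OfFamily F) // DomainSeq (stage3OfFamily F).L j.1.1.Ω})) _ _ h)

/-- ★ **THE RS-CURRENCY LEAF OVER THE PINNED «P₂C» DATA IS UNINHABITED AT THE FAMILY DICTIONARY** — for ALL residual constants and carriers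
`C₂ B₁′ B₀′ B₁ B₂ c₁ inp B₀β loc lan cub`: `¬ B8LeafKnitRS.B8LeafRS θ₀.D θ₀.L … (fun j : IdxB8SubC θ₀ => famB8OfRecordSubBP₂C θ₀ β len j) lan cub (fun j => toAxialTowerResid θ₀ β len j.1.1)`,
`θ₀ := stage3OfFamily F` (its `p7` field is the refuted conjunct) — so the hypothesis of `Node00.CarriersB8SubBP2C.b8LeafOfRecordSubBP₂C_of_b8LeafRS_pinned` has no instance
there («RS ⇒ slot, never conversely»: the RS side is EMPTY). [cite: Balaban1985RegularSpaces, Lemma 1 – Thm 8 pp.79–101 (the leaf), Prop. 7 (1.145) p.100] -/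
theorem not_b8LeafRS_famB8OfRecordSubBP₂C_toAxialTowerResid_stage3OfFamily {I₁ I₃ I₄ : Type} (C₂ B₁' B₀' B₁ B₂ c₁ : ℝ) (inp : B8.B9Inputs) (B₀β : ℝ)
    (loc : I₁ → B8.LocalData) (lan : I₃ → B8.LandauData) (cub : I₄ → B8.CubeData) :
    ¬ B8LeafRS (stage3OfFamily F).D ((stage3OfFamily F).L : ℝ) C₂ B₁' B₀' B₁ B₂ c₁ inp B₀β loc
      (fun j : IdxB8SubC (stage3OfFamily F) => famB8OfRecordSubBP₂C (stage3OfFamily F) β len j) lan cub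
      (fun j => toAxialTowerResid (stage3OfFamily F) β len j.1.1) :=
  fun h => not_prop7PrintedR_famB8OfRecordSubBP₂C_toAxialTowerResid_stage3OfFamily F β len h.p7

/-- … and over the P-members of the whole four-law sub-index `IdxB8SubB θ₀` (family `famB8OfRecordSubBP`, map `fun j => toAxialTowerResid θ₀ β len j.1`),
`θ₀ := stage3OfFamily F`. [cite: Balaban1985RegularSpaces, Lemma 1 – Thm 8 pp.79–101 (the leaf), Prop. 7 (1.145) p.100] -/
theorem not_b8LeafRS_famB8OfRecordSubBP_toAxialTowerResid_stage3OfFamily {I₁ I₃ I₄ : Type} (C₂ B₁' B₀' B₁ B₂ c₁ : ℝ) (inp : B8.B9Inputs) (B₀β : ℝ)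
    (loc : I₁ → B8.LocalData) (lan : I₃ → B8.LandauData) (cub : I₄ → B8.CubeData) :
    ¬ B8LeafRS (stage3OfFamily F).D ((stage3OfFamily F).L : ℝ) C₂ B₁' B₀' B₁ B₂ c₁ inp B₀β loc
      (fun j : IdxB8SubB (stage3OfFamily F) => famB8OfRecordSubBP (stage3OfFamily F) β len j) lan cub
      (fun j => toAxialTowerResid (stage3OfFamily F) β len j.1) :=
  fun h => not_prop7PrintedR_famB8OfRecordSubBP_toAxialTowerResid_stage3OfFamily F β len h.p7

end Family

/-! ## §3 The faces at the CLOSED DICTIONARY `stage3OfRecord₁₂` (`D = 4`, `L = 3` by `rfl`, any `𝔸`) -/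

section Record12

variable (β : ℝ) (len : Site (stage3OfRecord₁₂).D → ℝ)

/-- ★ A member `j : IdxB8SubC stage3OfRecord₁₂` (lawful, admissible, half-space tower) at which the typed-printed Proposition 7 for `famB8OfRecordSubBP₂C stage3OfRecord₁₂ β len j`
with `toAxialTowerResid` fails (`L = 3`: the case of n05-w2's `B8Prop7PrintedRZdGF3P2HalfSpace`, here through g0's every-`L` theorem at `L := 3`).
[cite: Balaban1985RegularSpaces, Prop. 7 (1.143)–(1.145) p.100, (1.3)–(1.4) p.77, p.77] -/
theorem exists_idxB8SubC_not_prop7PrintedR_stage3OfRecord₁₂ :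
    ∃ j : IdxB8SubC stage3OfRecord₁₂, j.1.1.1.Ω = OmegaHS (0 : Fin 4) ∧
      ¬ B8SectGH.Prop7PrintedR (fun _ : Unit => famB8OfRecordSubBP₂C stage3OfRecord₁₂ β len j)
        (fun _ => toAxialTowerResid stage3OfRecord₁₂ β len j.1.1) := by
  -- RE-KEY-NEUTRAL (director-ym №260, FLAG №14 T0 (γ)): the C⋆-GENERIC member certificate at `𝔸 := stage3OfRecord₁₂.𝔸`, whatever that algebra is.
  obtain ⟨i, hlaws, hadm, hΩ0, hΩ, hnot⟩ :=
    not_prop7PrintedR_zdGF3HP₂_toAxialTower_halfspace_cstar stage3OfRecord₁₂.𝔸 3 le_rfl (by norm_num) β len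
  exact ⟨⟨⟨⟨i, hΩ0⟩, hlaws⟩, hadm⟩, hΩ, hnot⟩

/-- ★★ The K1 record knits' `p7` binder with the map pinned is FALSE at the closed dictionary: `θ₀ := stage3OfRecord₁₂`,
`¬ B8SectGH.Prop7PrintedR (fun j : IdxB8SubB θ₀ => famB8OfRecordSubBP θ₀ β len j) (fun j => toAxialTowerResid θ₀ β len j.1)`. [cite: Balaban1985RegularSpaces, Prop. 7 (1.143)–(1.145) p.100, (1.35) p.82, p.77] -/
theorem not_prop7PrintedR_famB8OfRecordSubBP_toAxialTowerResid_stage3OfRecord₁₂ :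
    ¬ B8SectGH.Prop7PrintedR (fun j : IdxB8SubB stage3OfRecord₁₂ => famB8OfRecordSubBP stage3OfRecord₁₂ β len j)
      (fun j => toAxialTowerResid stage3OfRecord₁₂ β len j.1) := by
  obtain ⟨j, -, hnot⟩ := exists_idxB8SubC_not_prop7PrintedR_stage3OfRecord₁₂ β len
  exact fun h => hnot (prop7PrintedR_precomp (fun _ : Unit => j.1) _ _ h)

/-- ★★ … over the «P₂C» slot's index `IdxB8SubC θ₀`, `θ₀ := stage3OfRecord₁₂`. [cite: Balaban1985RegularSpaces, Prop. 7 (1.143)–(1.145) p.100, (1.3)–(1.4) p.77] -/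
theorem not_prop7PrintedR_famB8OfRecordSubBP₂C_toAxialTowerResid_stage3OfRecord₁₂ :
    ¬ B8SectGH.Prop7PrintedR (fun j : IdxB8SubC stage3OfRecord₁₂ => famB8OfRecordSubBP₂C stage3OfRecord₁₂ β len j)
      (fun j => toAxialTowerResid stage3OfRecord₁₂ β len j.1.1) := by
  obtain ⟨j, -, hnot⟩ := exists_idxB8SubC_not_prop7PrintedR_stage3OfRecord₁₂ β len
  exact fun h => hnot (prop7PrintedR_precomp (fun _ : Unit => j) _ _ h)

/-- … over the admissible subtype `{j : IdxB8SubB θ₀ ∕∕ DomainSeq θ₀.L j.1.1.Ω}`, `θ₀ := stage3OfRecord₁₂`. [cite: Balaban1985RegularSpaces, Prop. 7 (1.143)–(1.145) p.100, (1.3)–(1.4) p.77] -/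
theorem not_prop7PrintedR_famB8OfRecordSubBP_domainSeq_toAxialTowerResid_stage3OfRecord₁₂ :
    ¬ B8SectGH.Prop7PrintedR
      (fun j : {j : IdxB8SubB stage3OfRecord₁₂ // DomainSeq stage3OfRecord₁₂.L j.1.1.Ω} => famB8OfRecordSubBP stage3OfRecord₁₂ β len j.1)
      (fun j => toAxialTowerResid stage3OfRecord₁₂ β len j.1.1) := by
  obtain ⟨j, -, hnot⟩ := exists_idxB8SubC_not_prop7PrintedR_stage3OfRecord₁₂ β len
  exact fun h => hnot (prop7PrintedR_precomp
    (fun _ : Unit => (⟨j.1, j.2⟩ : {j : IdxB8SubB stage3OfRecord₁₂ // DomainSeq stage3OfRecord₁₂.L j.1.1.Ω})) _ _ h)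

/-- ★ The RS-currency leaf over the pinned «P₂C» data is uninhabited at the closed dictionary, for all residual constants and carriers.
[cite: Balaban1985RegularSpaces, Lemma 1 – Thm 8 pp.79–101 (the leaf), Prop. 7 (1.145) p.100] -/
theorem not_b8LeafRS_famB8OfRecordSubBP₂C_toAxialTowerResid_stage3OfRecord₁₂ {I₁ I₃ I₄ : Type} (C₂ B₁' B₀' B₁ B₂ c₁ : ℝ) (inp : B8.B9Inputs) (B₀β : ℝ)
    (loc : I₁ → B8.LocalData) (lan : I₃ → B8.LandauData) (cub : I₄ → B8.CubeData) :
    ¬ B8LeafRS stage3OfRecord₁₂.D (stage3OfRecord₁₂.L : ℝ) C₂ B₁' B₀' B₁ B₂ c₁ inp B₀β loc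
      (fun j : IdxB8SubC stage3OfRecord₁₂ => famB8OfRecordSubBP₂C stage3OfRecord₁₂ β len j) lan cub
      (fun j => toAxialTowerResid stage3OfRecord₁₂ β len j.1.1) :=
  fun h => not_prop7PrintedR_famB8OfRecordSubBP₂C_toAxialTowerResid_stage3OfRecord₁₂ β len h.p7

/-- … and over the P-members of `IdxB8SubB θ₀`, `θ₀ := stage3OfRecord₁₂`. [cite: Balaban1985RegularSpaces, Lemma 1 – Thm 8 pp.79–101 (the leaf), Prop. 7 (1.145) p.100] -/
theorem not_b8LeafRS_famB8OfRecordSubBP_toAxialTowerResid_stage3OfRecord₁₂ {I₁ I₃ I₄ : Type} (C₂ B₁' B₀' B₁ B₂ c₁ : ℝ) (inp : B8.B9Inputs) (B₀β : ℝ)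
    (loc : I₁ → B8.LocalData) (lan : I₃ → B8.LandauData) (cub : I₄ → B8.CubeData) :
    ¬ B8LeafRS stage3OfRecord₁₂.D (stage3OfRecord₁₂.L : ℝ) C₂ B₁' B₀' B₁ B₂ c₁ inp B₀β loc
      (fun j : IdxB8SubB stage3OfRecord₁₂ => famB8OfRecordSubBP stage3OfRecord₁₂ β len j) lan cub
      (fun j => toAxialTowerResid stage3OfRecord₁₂ β len j.1) :=
  fun h => not_prop7PrintedR_famB8OfRecordSubBP_toAxialTowerResid_stage3OfRecord₁₂ β len h.p7

end Record12

end Literature.MathematicalPhysics.QuantumFieldTheory.Balaban1983to89.B8Prop7PrintedRTowerAxialRecordP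

end
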